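import Summits.BirchSwinnertonDyer.BirchSwinnertonDyer.Theorems.KimAtThreeKolyvaginPortSharedEnds
import Summits.BirchSwinnertonDyer.BirchSwinnertonDyer.Theorems.KimAtThreePortSharedC2Supply
import Summits.BirchSwinnertonDyer.BirchSwinnertonDyer.Theorems.KimAtThreeShallowEqDeepNoStubCruxes
import HarnessLib

/-!
# Crux `DeepUpperAtThree` (stmt-BirchSwinnertonDyer-19076) at every CLEAN Kato-stratum row from the
# published inputs + the fine Kato witnesses ALONE — no certificate, no stub, no PORT binder
# (cell `bsd-addord`, seat w2-c3 gen 4; route W2 `KimAtThreeKolyvagin`)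

kim3 gen 10's row ENDs (`KimAtThreeKolyvaginPortSharedEnds`, p456984) replaced the PORT″ binder of the
three W2 crux conclusions on a CLEAN Kato-stratum row (no bad `w ≠ 3` with `E(ℚ_w)[3] ≠ 0`) by the row's
fine Kato witnesses (C1 at the row) plus ONE unit-minus-symbol certificate `(q, n, t, a₀)`; his 19076 END
moreover kept the STUB at the empty level (crux 19561, binder `hStub`).  Both extra inputs are now
theorems of the tree: the certificate by this seat's `KimAtThreePortSharedC2Supply.unitMinusSymbol_row`
(p457409: Manin's relation + the definition of `Ω⁻` + Chebotarev, class-wide), the stub by w2-c4's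
no-stub road (`KimAtThreeShallowEqDeepNoStubCruxes.deepUpper_optimal_of_poitouTate_noStub`, p444204).
This file (theorems only; 0 defs / 0 facts / 0 sorry) wires them:

* `portShared_row_of_witnesses_of_noAnomalous` — PORT″ `KatoKuriharaPortThreeAtWith₂ W 0 v₃ η P` at a
  clean row from the row's fine Kato witnesses ONLY (kim3's `portShared_row_of_witnesses_of_cert_of_noAnomalous`
  with the certificate supplied by `unitMinusSymbol_row`);
* `deepUpper_optimal_of_witnesses_of_noAnomalous` — **crux 19076's conclusion
  `∂^{(∞)}_deep = d ∈ ℕ ∧ ord₃ #Ш(3) + d ≤ ∂⁽⁰⁾` at a clean optimal Kato-stratum row `(W, D)` GRANTED ONLY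
  [S24] (1)(2), GZK, Poitou–Tate (published, by name) and the row's fine Kato witnesses** (C1 at the row:
  Kato's `ZetaBody` family for `D.f` with the finite-level `exp*` riders and a rational `3`-unit constant —
  the conclusion of the published fact `Kato2004.exists_eulerSystem_expStar_values` plus n1011's
  construction-shaped riders), plus the row data (`3`-integral plus symbols, `ord(δ̃) = 0`).

So on the 26 245 clean census rows the residual of 19076 is (C1) alone; on the 101 251 anomalous rows
it is (C1) + (C3) (`KimAtThreePortSharedC2Supply.katoKuriharaPortThreeShared_of_fineKato_of_anomalousRows`).
HONEST LIMITS: row theorems with displayed hypotheses; nothing is booked; 19076 / 19560 stay open.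
References: [Kato2004Asterisque] §8.1, Prop. 8.12, §9.4, Thm. 9.7, Thm. 6.6 (1), Ex. 13.3;
[Kim2022StructureSelmer] Thm. 3.13; [Kim2025RefinedTNC] Thm. 1.1; [Sakamoto2024] Thm. 4.4;
[MilneADT2006] I.4.10; [Manin1972] Thm. 1.6; [TateGCFT1967] §2.4; kim3 memo KIM3-W2-PORT-g10.md; w2-c3
memos W2C3-C2PRIME-CLASSWIDE-g4.md / W2C3-C3-LOCAL-ANALYSIS-g4.md.
-/

-- every file of this route lives in `Summit.BirchSwinnertonDyer.BirchSwinnertonDyer.Theorems.*` (summit =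
-- problem name), so the duplicated-namespace linter is moot here (as in kim3's `KimAtThreeKolyvaginPortShared`).
set_option linter.dupNamespace false

noncomputable section

open scoped NumberField TensorProduct Classical
open Function Field Finset IsDedekindDomain NumberField WeierstrassCurve Rat.HeightOneSpectrum
open Literature.NumberTheory.GaloisRepresentations Literature.NumberTheory.GaloisCohomology
open Literature.NumberTheory.GaloisRepresentations.DiscreteGaloisModule
open Literature.NumberTheory.EllipticCurves Literature.NumberTheory.EllipticCurves.ModularForms
open Literature.NumberTheory.EllipticCurves.Rank1Residual
open Literature.NumberTheory.EllipticCurves.Kato2004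
open Literature.NumberTheory.EllipticCurves.Kato2004.EulerSystemValues
open Summit.BirchSwinnertonDyer.Rank1Residual.GaloisImage
open Summit.BirchSwinnertonDyer.BirchSwinnertonDyer.Theorems

namespace Summit.BirchSwinnertonDyer.BirchSwinnertonDyer.Theorems.KimAtThreeDeepUpperCleanRows

/-! ### §1. PORT″ at a clean row from the fine Kato witnesses alone -/

/-- **PORT″ at a clean Kato-stratum row from the row's fine Kato witnesses ONLY.**  For `W` with the
`3`-adic tower onto, additive at `3`, `E(ℚ₃)[3] = 0`, a parametrisation datum `P` at the conductor level,
fine Kato witnesses `(ι, κ, Λ, Λfin)` (riders at every depth, `κ` a rational `3`-unit, the `ZetaBody`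
family of `P.f` for all admissible auxiliary data) and NO anomalous bad place:
`KatoKuriharaPortThreeAtWith₂ W 0 v₃ η P`.  kim3's `portShared_row_of_witnesses_of_cert_of_noAnomalous`
with its certificate `(q, n, t, a₀)` produced by `KimAtThreePortSharedC2Supply.unitMinusSymbol_row`
(`ρ̄₃` onto from the tower at `m = 1`; `3 ∣ N` from `Addv W 3` and `N = N_W`).
[cite: Kato2004Asterisque, (8.1.3) (p. 180), Prop. 8.12 (p. 186), Thm. 9.7 (p. 189), Thm. 6.6 (1) (p. 163), Ex. 13.3 (pp. 224–225)]
[cite: Kim2022StructureSelmer, Thm. 3.13 and §3.3–§3.4.1] [cite: Manin1972, Prop. 1.4  Thm. 1.6]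
[cite: TateGCFT1967, §2.4 (Tchebotarev density theorem)] -/
theorem portShared_row_of_witnesses_of_noAnomalous
    (W : WeierstrassCurve ℚ) [W.IsElliptic] [W.IsGloballyMinimal]
    [ContinuousSMul ℤ_[3] (W.tateModule 3)] [Module.Free ℤ_[3] (W.tateModule 3)]
    [Module.Finite ℤ_[3] (W.tateModule 3)]
    (htow : ∀ m : ℕ, W.HasSurjectiveModNGaloisRep (3 ^ m : ℕ))
    (hadd : haveI : Fact (Nat.Prime 3) := ⟨Nat.prime_three⟩; Addv W 3)
    (ht : Nat.card {Q : (W.baseChange ℚ_[3]).toAffine.Point // (3 : ℕ) • Q = 0} = 1)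
    (v₃ : HeightOneSpectrum (𝓞 ℚ))
    (η : (q : HeightOneSpectrum (𝓞 ℚ)) → (ZMod (Ideal.absNorm q.asIdeal))ˣ)
    {N : ℕ} [NeZero N] (P : ModularParametrizationData W N) (hN : N = W.conductorNorm ℤ)
    -- the fine Kato witnesses of the row (C1 at this row)
    {ι : (n : ℕ) → (CyclotomicField n ℚ →+* ℂ)} {κK : ℝ}
    {Λ : ∀ (k' : ℕ) (r : Finset (HeightOneSpectrum (𝓞 ℚ))),
      H1 (tateRep W 3) (cycSubgroup 3 k' r) →ₗ[ℤ_[3]] ℚ_[3] ⊗[ℚ] CyclotomicField (cycLevel 3 k' r) ℚ}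
    (Λfin : ∀ j : ℕ, galoisCohomology
      ((W.torsionGaloisModule (((3 : ℕ) : ℤ) ^ j * ((3 : ℕ) : ℤ))).toLocal (Sum.inr v₃)) 1 →+
        ZMod (3 ^ (j + 1)))
    (hκ0 : κK ≠ 0) (hNorm : ∃ u : ℚ, (u : ℝ) = κK ∧ padicValRat 3 u = 0)
    (hfin : ∀ j : ℕ, KatoExpStarFiniteLevelAt W 3 j 0 v₃ Λ (Λfin j))
    (hz : ∀ (c d a : ℤ) (A : ℕ), 0 < A → Int.gcd c (6 * 3 * A) = 1 → Int.gcd d (6 * 3 * N) = 1 →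
      ∃ (z : ∀ (k' : ℕ) (r : (cyclotomicLevelsRat 3 (badPlaces c d A N)).Ideals),
            H1 (tateRep W 3) ((cyclotomicLevelsRat 3 (badPlaces c d A N)).level k' r.1))
        (x : ∀ (k' : ℕ) (r : (cyclotomicLevelsRat 3 (badPlaces c d A N)).Ideals),
            CyclotomicField (cycLevel 3 k' r.1) ℚ),
        ZetaBody W 3 P.f ι κK Λ c d a A z x)
    -- no anomalous bad place
    (hbad : ∀ w : HeightOneSpectrum (𝓞 ℚ), ¬ W.HasGoodReductionAt w →
      ((primesEquiv w : Nat.Primes) : ℕ) ≠ 3 →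
        ∀ Q : (W.baseChange (w.adicCompletion ℚ)).toAffine.Point, 3 • Q = 0 → Q = 0) :
    KatoKuriharaPortThreeAtWith₂ W 0 v₃ η P := by
  haveI : Fact (Nat.Prime 3) := ⟨Nat.prime_three⟩
  have hs : W.HasSurjectiveModNGaloisRep (3 : ℕ) := by simpa using htow 1
  have h9 : 3 ^ 2 ∣ N := hN ▸ KimAtThreeKolyvaginPortShared.sq_dvd_conductorNorm_of_addv W hadd
  have h3N : 3 ∣ N := dvd_trans (dvd_pow_self 3 two_ne_zero) h9
  obtain ⟨q, n, t, a₀, hq, hq3, hqN, hn, hat, h3t, hX0, hX⟩ :=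
    KimAtThreePortSharedC2Supply.unitMinusSymbol_row W hs h3N P
  exact KimAtThreeKolyvaginPortSharedEnds.portShared_row_of_witnesses_of_cert_of_noAnomalous W htow hadd
    ht v₃ η P hN Λfin hκ0 hNorm hfin hz hq hq3 hqN hn hat h3t hX0 hX hbad

/-! ### §2. Crux 19076's conclusion at a clean optimal row: published inputs + fine Kato witnesses -/

/-- **Crux 19076 (`DeepUpperAtThree`)'s conclusion at a clean optimal Kato-stratum row `(W, D)` from the
PUBLISHED inputs and the row's fine Kato witnesses alone** — no certificate (this seat's
`unitMinusSymbol_row`), no stub (w2-c4's `deepUpper_optimal_of_poitouTate_noStub`), no PORT binder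
(`portShared_row_of_witnesses_of_noAnomalous`).  GRANTED [S24] Thm 4.4 (1)(2), GZK and Poitou–Tate (by
name): for `W` additive at `3` with `3 ∤ c₃`, tower onto, `E(ℚ₃)[3] = 0`, `D` lattice-optimal at the
conductor level with `3 ∤` Manin constant, `3`-integral plus symbols, `ord(δ̃) = 0`, fine Kato witnesses
for `D.f`, and no anomalous bad place: `∂^{(∞)}_deep(δ̃) = d ∈ ℕ` and `ord₃ #Ш(W)[3^∞] + d ≤ ∂⁽⁰⁾(δ̃)`.
[cite: Kim2025RefinedTNC, Thm 1.1] [cite: Sakamoto2024, Thm. 4.4 (p. 926)] [cite: MilneADT2006, Ch. I, Thm. 4.10]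
[cite: Kato2004Asterisque, (8.1.3) (p. 180), Prop. 8.12 (p. 186), Thm. 9.7 (p. 189), Thm. 6.6 (1) (p. 163), Ex. 13.3 (pp. 224–225)] -/
theorem deepUpper_optimal_of_witnesses_of_noAnomalous
    (hS24 : Sakamoto2024.kolyvaginSystems_freeRankOne_zmod_three_pow)
    (hS24₂ : Sakamoto2024.kolyvaginSystems_idealOfBasis_eq_fittingIdeal_zmod_three_pow)
    (hGZK : rank_eq_analyticRank_of_analyticRank_le_one)
    (hPT : poitouTate_selmerStructure_duality ℚ)
    (W : WeierstrassCurve ℚ) [W.IsElliptic] [W.IsGloballyMinimal]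
    [ContinuousSMul ℤ_[3] (W.tateModule 3)] [Module.Free ℤ_[3] (W.tateModule 3)]
    [Module.Finite ℤ_[3] (W.tateModule 3)]
    (hadd : haveI : Fact (Nat.Prime 3) := ⟨Nat.prime_three⟩; Addv W 3)
    (hc3 : ¬ 3 ∣ (W.baseChange ℚ_[3]).localTamagawaNumber ℤ_[3])
    (htower : ∀ m : ℕ, W.HasSurjectiveModNGaloisRep (3 ^ m : ℕ))
    (ht0 : Nat.card {Q : (W.baseChange ℚ_[3]).toAffine.Point // (3 : ℕ) • Q = 0} = 1)
    {N : ℕ} [NeZero N] (hN : N = W.conductorNorm ℤ) (D : ModularParametrizationData W N)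
    (hopt : ∀ z ∈ D.L.lattice, ∃ w ∈ periodLattice D.f, z = D.c * w)
    (hcD : ¬ (3 : ℤ) ∣ D.maninConstant)
    (hint : ∀ r : ℚ, ratPlusSymbol D.f r ≠ 0 → 0 ≤ padicValRat 3 (ratPlusSymbol D.f r))
    (hord : kuriharaVanishingOrder W 3 D.f = 0)
    (v₃ : HeightOneSpectrum (𝓞 ℚ)) (hv₃ : ((3 : ℕ) : 𝓞 ℚ) ∈ v₃.asIdeal)
    (η : (q : HeightOneSpectrum (𝓞 ℚ)) → (ZMod (Ideal.absNorm q.asIdeal))ˣ)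
    (hη : ∀ q : HeightOneSpectrum (𝓞 ℚ), Subgroup.zpowers (η q) = ⊤)
    -- the fine Kato witnesses of the row (C1 at this row)
    {ι : (n : ℕ) → (CyclotomicField n ℚ →+* ℂ)} {κK : ℝ}
    {Λ : ∀ (k' : ℕ) (r : Finset (HeightOneSpectrum (𝓞 ℚ))),
      H1 (tateRep W 3) (cycSubgroup 3 k' r) →ₗ[ℤ_[3]] ℚ_[3] ⊗[ℚ] CyclotomicField (cycLevel 3 k' r) ℚ}
    (Λfin : ∀ j : ℕ, galoisCohomology
      ((W.torsionGaloisModule (((3 : ℕ) : ℤ) ^ j * ((3 : ℕ) : ℤ))).toLocal (Sum.inr v₃)) 1 →+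
        ZMod (3 ^ (j + 1)))
    (hκ0 : κK ≠ 0) (hNorm : ∃ u : ℚ, (u : ℝ) = κK ∧ padicValRat 3 u = 0)
    (hfin : ∀ j : ℕ, KatoExpStarFiniteLevelAt W 3 j 0 v₃ Λ (Λfin j))
    (hz : ∀ (c d a : ℤ) (A : ℕ), 0 < A → Int.gcd c (6 * 3 * A) = 1 → Int.gcd d (6 * 3 * N) = 1 →
      ∃ (z : ∀ (k' : ℕ) (r : (cyclotomicLevelsRat 3 (badPlaces c d A N)).Ideals),
            H1 (tateRep W 3) ((cyclotomicLevelsRat 3 (badPlaces c d A N)).level k' r.1))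
        (x : ∀ (k' : ℕ) (r : (cyclotomicLevelsRat 3 (badPlaces c d A N)).Ideals),
            CyclotomicField (cycLevel 3 k' r.1) ℚ),
        ZetaBody W 3 D.f ι κK Λ c d a A z x)
    -- no anomalous bad place
    (hbad : ∀ w : HeightOneSpectrum (𝓞 ℚ), ¬ W.HasGoodReductionAt w →
      ((primesEquiv w : Nat.Primes) : ℕ) ≠ 3 →
        ∀ Q : (W.baseChange (w.adicCompletion ℚ)).toAffine.Point, 3 • Q = 0 → Q = 0) :
    ∃ dd : ℕ, kuriharaPartialDeepInfty W 3 D.f = dd ∧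
      ((padicValNat 3 (Nat.card (AddCommGroup.primaryComponent W.sha 3)) + dd : ℕ) : ℕ∞) ≤
        kuriharaPartial W 3 D.f 0 :=
  KimAtThreeShallowEqDeepNoStubCruxes.deepUpper_optimal_of_poitouTate_noStub hS24 hS24₂ hGZK hPT W hadd
    hc3 htower ht0 D hopt hcD hint hord v₃ hv₃ η hη
    (portShared_row_of_witnesses_of_noAnomalous W htower hadd ht0 v₃ η D hN Λfin hκ0 hNorm hfin hz hbad)

end Summit.BirchSwinnertonDyer.BirchSwinnertonDyer.Theorems.KimAtThreeDeepUpperCleanRows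

end
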